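import Mathlib.LinearAlgebra.TensorProduct.Matrix
import Literature.NumberTheory.GaloisRepresentations.UnramifiedDatum
import Literature.NumberTheory.GaloisRepresentations.DrigArtinianFunctor
import Literature.NumberTheory.Automorphic.LocalConstants
import Literature.NumberTheory.Automorphic.LParameter
import HarnessLib

/-!
# The Kronecker frame: `FramedRep.tensor` is the tensor product representation; tensor products of
# isomorphisms of (Weil–Deligne) representations

Topic `Literature/NumberTheory/GaloisRepresentations`; definitions and theorems only (no named fact, no
instance).  Bookkeeping between the two tensor products the tree uses: the MATRIX one — the accepted
`glKronecker g h ∈ GL_{mn}(A)` (Kronecker product reindexed by `finProdFinEquiv`) and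
`FramedRep.tensor ρ ρ' : G →ₜ* GL_{mn}(A)`, `g ↦ ρ(g) ⊗ ρ'(g)` (file `DrigArtinianFunctor`) — and the
MODULE one — Mathlib's `Representation.tprod` on `V ⊗[A] V'` and the accepted `WeilDeligneRep.tprod`
`(r ⊗ r', N ⊗ 1 + 1 ⊗ N')` (file `LocalConstants`; Deligne 1973 §8, Tate 1979 (4.1.5)).  Needed by
every statement that moves a local–global compatibility clause (`IsWeilDeligneOfLadic`,
`PstWeilDeligneData.IsWeilDeligneOf`, both phrased on `Fin n → ℚ̄_ℓ`) through a Kronecker product of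
framed Galois representations, in particular by the candidate clause (F15)
`PstWeilDeligneData.TensorCompatible` (file `PstWeilDeligneTensorCompatible`).

## What this file provides (no `sorry`)

* `kroneckerBasis`, `kroneckerFrame` — the Kronecker frame
  `(Fin m → C) ⊗[C] (Fin n → C) ≃ₗ[C] (Fin (m·n) → C)`, `e_i ⊗ e_j ↦ e_{finProdFinEquiv (i,j)}`, with
  `toMatrix_kroneckerBasis_map` / `kroneckerFrame_map_toLin'` / `kroneckerFrame_comp_map_toLin'`: in
  this frame `TensorProduct.map (toLin' G) (toLin' H)` has matrix `reindex (G ⊗ₖ H)` (Mathlib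
  `TensorProduct.toMatrix_map`) — the convention of `glKronecker`;
* `FramedRep.tensorRepresentationEquiv` (`ρ ⊗ ρ' ≅ FramedRep.tensor ρ ρ'` as representations of `G`),
  `FramedRep.weilRestrictTensorEquiv` (the same after restriction to `W_F`, `FramedRep.weilRestrict`),
  `FramedRep.IsLocallyUnramified.tensor` (unramified `⊗` unramified is unramified);
* `Representation.Equiv.tprodCongr` (deliberate dot-notation extension of Mathlib's
  `Representation.Equiv`: Mathlib has `IntertwiningMap.tensor` but no bundled equivalence),
  `WeilDeligneRep.Equiv.tprodCongr` and `WeilDeligneRep.IsEquivalent.tprod` (isomorphism classes of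
  Weil–Deligne representations are `⊗`-stable; generalises the accepted `Equiv.tprodLeft`, which is
  over `ℂ` and one-sided), `WeilDeligneRep.Equiv.ofRepEquiv` / `Equiv.ofRepEquivOfN`,
  `WeilDeligneRep.ofRepTprodEquiv` (`(ρ,0) ⊗ (σ,0) = (ρ ⊗ σ, 0)`), `WeilGroup.IsContinuousRep.tprod`,
  and `FramedRep.isEquivalent_ofRep_weilRestrict_tensor`:
  `((ρ ⊗ ρ')|_{W_F}, 0) ≅ (ρ|_{W_F}, 0) ⊗ (ρ'|_{W_F}, 0)`.

## References

* P. Deligne, *Les constantes des équations fonctionnelles des fonctions L*, Antwerp II, LNM 349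
  (1973), §8.4.1 (Weil–Deligne representations, morphisms, tensor products). [DeligneAntwerpII1973]
* J. Tate, *Number theoretic background*, Corvallis 1979, (4.1.2)–(4.1.6). [TateCorvallis1979]
* N. Bourbaki, *Algebra I* (Chapters 1–3), II §10 no. 10 (tensor product of matrices = matrix of
  `φ ⊗ ψ` in the product bases). [BourbakiAlgebraI1989]
-/
noncomputable section

open scoped TensorProduct Kronecker MatrixGroups Matrix
open Field

namespace Literature.NumberTheory.GaloisRepresentations

/-! ### §1 The Kronecker frame -/

section KroneckerFrame

variable (C : Type*) [CommRing C] (m n : ℕ)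

/-- **The Kronecker basis** of `(Fin m → C) ⊗[C] (Fin n → C)`: the tensor products `e_i ⊗ e_j` of the
standard basis vectors, indexed by `Fin (m * n)` through `finProdFinEquiv` (row-major, `(i, j) ↦ i·n + j`)
— the frame in which the accepted `glKronecker` / `FramedRep.tensor` write the Kronecker product.
[folklore] -/
def kroneckerBasis : Module.Basis (Fin (m * n)) C ((Fin m → C) ⊗[C] (Fin n → C)) :=
  ((Pi.basisFun C (Fin m)).tensorProduct (Pi.basisFun C (Fin n))).reindex finProdFinEquiv

/-- **The Kronecker frame**: the coordinate isomorphism `(Fin m → C) ⊗[C] (Fin n → C) ≃ₗ[C]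
(Fin (m * n) → C)` of the Kronecker basis (`e_i ⊗ e_j ↦ e_{finProdFinEquiv (i, j)}`). [folklore] -/
def kroneckerFrame : ((Fin m → C) ⊗[C] (Fin n → C)) ≃ₗ[C] (Fin (m * n) → C) :=
  (kroneckerBasis C m n).equivFun

variable {C m n}

/-- **In the Kronecker basis, `f ⊗ g` has matrix `G ⊗ₖ H`** (reindexed by `finProdFinEquiv`), where
`G`, `H` are the standard matrices of `f = toLin' G`, `g = toLin' H` (Mathlib `TensorProduct.toMatrix_map`;
Bourbaki, *Algebra* II §10 no. 10: "`A ⊗ B` is the matrix of `φ ⊗ ψ` with respect to the bases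
`(e_λ ⊗ f_μ)`, `(u_ρ ⊗ v_σ)`", here ordered by `finProdFinEquiv`). [cite: BourbakiAlgebraI1989, II §10 no. 10] -/
theorem toMatrix_kroneckerBasis_map (G : Matrix (Fin m) (Fin m) C) (H : Matrix (Fin n) (Fin n) C) :
    LinearMap.toMatrix (kroneckerBasis C m n) (kroneckerBasis C m n)
        (TensorProduct.map (Matrix.toLin' G) (Matrix.toLin' H)) =
      Matrix.reindex finProdFinEquiv finProdFinEquiv (G ⊗ₖ H) := by
  ext k l
  rw [LinearMap.toMatrix_apply, kroneckerBasis, Module.Basis.repr_reindex_apply,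
    Module.Basis.reindex_apply, ← LinearMap.toMatrix_apply, TensorProduct.toMatrix_map,
    Matrix.reindex_apply, Matrix.submatrix_apply]
  simp only [LinearMap.toMatrix_eq_toMatrix', LinearMap.toMatrix'_toLin']

/-- **Coordinates in the Kronecker frame transform by the Kronecker matrix**:
`kroneckerFrame ((toLin' G ⊗ toLin' H) x) = reindex (G ⊗ₖ H) *ᵥ kroneckerFrame x` (Bourbaki,
*Algebra* II §10 no. 10, formula (43)). [cite: BourbakiAlgebraI1989, II §10 no. 10] -/
theorem kroneckerFrame_map_toLin' (G : Matrix (Fin m) (Fin m) C) (H : Matrix (Fin n) (Fin n) C)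
    (x : (Fin m → C) ⊗[C] (Fin n → C)) :
    kroneckerFrame C m n (TensorProduct.map (Matrix.toLin' G) (Matrix.toLin' H) x) =
      Matrix.reindex finProdFinEquiv finProdFinEquiv (G ⊗ₖ H) *ᵥ kroneckerFrame C m n x := by
  rw [kroneckerFrame, Module.Basis.equivFun_apply, Module.Basis.equivFun_apply,
    ← toMatrix_kroneckerBasis_map, LinearMap.toMatrix_mulVec_repr]

/-- The same, as an identity of linear maps:
`kroneckerFrame ∘ (toLin' G ⊗ toLin' H) = toLin' (reindex (G ⊗ₖ H)) ∘ kroneckerFrame` (Bourbaki,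
*Algebra* II §10 no. 10). [cite: BourbakiAlgebraI1989, II §10 no. 10] -/
theorem kroneckerFrame_comp_map_toLin' (G : Matrix (Fin m) (Fin m) C) (H : Matrix (Fin n) (Fin n) C) :
    (kroneckerFrame C m n : _ →ₗ[C] (Fin (m * n) → C)) ∘ₗ
        TensorProduct.map (Matrix.toLin' G) (Matrix.toLin' H) =
      Matrix.toLin' (Matrix.reindex finProdFinEquiv finProdFinEquiv (G ⊗ₖ H)) ∘ₗ
        (kroneckerFrame C m n : _ →ₗ[C] (Fin (m * n) → C)) := by
  refine LinearMap.ext fun x => ?_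
  rw [LinearMap.comp_apply, LinearMap.comp_apply, LinearEquiv.coe_coe, kroneckerFrame_map_toLin',
    Matrix.toLin'_apply]

end KroneckerFrame

/-! ### §2 `FramedRep.tensor` is the tensor product of representations, in the Kronecker frame -/

section FramedRepTensor

variable {G : Type*} [Group G] [TopologicalSpace G] {A : Type*} [CommRing A] [TopologicalSpace A]
  [IsTopologicalRing A] {m n : ℕ}

omit [IsTopologicalRing A] in
/-- The linear map `ρ(g)` underlying a framed representation is `toLin'` of the matrix `ρ(g)`
(private unfolding helper). [folklore] -/
private theorem toRepresentation_eq_toLin'_aux (ρ : FramedRep G A n) (g : G) :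
    ρ.toRepresentation g = Matrix.toLin' ((ρ g : GL (Fin n) A) : Matrix (Fin n) (Fin n) A) := by
  refine LinearMap.ext fun v => ?_
  rw [FramedRep.toRepresentation_apply_apply, Matrix.toLin'_apply]

/-- **`ρ ⊗ ρ' ≅ FramedRep.tensor ρ ρ'`** as representations of `G` on `(Fin m → A) ⊗ (Fin n → A)`,
resp. `Fin (m * n) → A`, through the Kronecker frame: the accepted `FramedRep.tensor` (`g ↦
glKronecker (ρ g) (ρ' g)`) IS the tensor product representation written in the basis `e_i ⊗ e_j`.
[folklore] -/
def FramedRep.tensorRepresentationEquiv (ρ : FramedRep G A m) (ρ' : FramedRep G A n) :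
    Representation.Equiv (ρ.toRepresentation.tprod ρ'.toRepresentation)
      (ρ.tensor ρ').toRepresentation :=
  Representation.Equiv.mk (kroneckerFrame A m n) fun g => by
    rw [Representation.tprod_apply, toRepresentation_eq_toLin'_aux,
      toRepresentation_eq_toLin'_aux, toRepresentation_eq_toLin'_aux,
      FramedRep.tensor_apply, coe_glKronecker, kroneckerFrame_comp_map_toLin']

end FramedRepTensor

section WeilRestrict

variable {F : Type} [Field F] [ValuativeRel F] [TopologicalSpace F] [IsNonarchimedeanLocalField F]
  {A : Type*} [CommRing A] [TopologicalSpace A] [IsTopologicalRing A] {m n : ℕ}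

omit [IsTopologicalRing A] in
/-- The restriction to `W_F` of a framed representation, at `w`, is `toLin'` of the matrix
`ρ(w)` (private unfolding helper). [folklore] -/
private theorem weilRestrict_eq_toLin'_aux (ρ : FramedRep (absoluteGaloisGroup F) A n)
    (w : WeilGroup F) :
    ρ.weilRestrict F w =
      Matrix.toLin' ((ρ (WeilGroup.toAbsGalois F w) : GL (Fin n) A) : Matrix (Fin n) (Fin n) A) := by
  refine LinearMap.ext fun v => ?_
  rw [FramedRep.weilRestrict_apply_apply, Matrix.toLin'_apply]

/-- **`ρ|_{W_F} ⊗ ρ'|_{W_F} ≅ (ρ ⊗ ρ')|_{W_F}`** (Kronecker frame), for framed representations of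
`Γ_F` restricted to the Weil group (`FramedRep.weilRestrict`). [folklore] -/
def FramedRep.weilRestrictTensorEquiv (ρ : FramedRep (absoluteGaloisGroup F) A m)
    (ρ' : FramedRep (absoluteGaloisGroup F) A n) :
    Representation.Equiv ((ρ.weilRestrict F).tprod (ρ'.weilRestrict F))
      ((ρ.tensor ρ').weilRestrict F) :=
  Representation.Equiv.mk (kroneckerFrame A m n) fun w => by
    rw [Representation.tprod_apply, weilRestrict_eq_toLin'_aux,
      weilRestrict_eq_toLin'_aux, weilRestrict_eq_toLin'_aux,
      FramedRep.tensor_apply, coe_glKronecker, kroneckerFrame_comp_map_toLin']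

/-- **Unramified ⊗ unramified is unramified** (framed representations of `Γ_F`, `I_F = absInertia F`).
[cite: TateCorvallis1979, (4.1.6)] -/
theorem FramedRep.IsLocallyUnramified.tensor {ρ : FramedRep (absoluteGaloisGroup F) A m}
    {ρ' : FramedRep (absoluteGaloisGroup F) A n} (h : ρ.IsLocallyUnramified)
    (h' : ρ'.IsLocallyUnramified) : (ρ.tensor ρ').IsLocallyUnramified := fun σ hσ => by
  rw [FramedRep.tensor_apply, h σ hσ, h' σ hσ, glKronecker_one]

end WeilRestrict

end Literature.NumberTheory.GaloisRepresentations

/-! ### §3 Tensor products of isomorphisms of (Weil–Deligne) representations -/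

/-- **`⊗` of isomorphisms of representations** (deliberate dot-notation extension of Mathlib's
`Representation.Equiv`, which has `IntertwiningMap.tensor` but no bundled equivalence version):
`e ⊗ e' : ρ ⊗ ρ' ≅ σ ⊗ σ'` (`TensorProduct.congr`). [folklore] -/
def Representation.Equiv.tprodCongr {k G V V' W W' : Type*} [CommSemiring k] [Monoid G]
    [AddCommMonoid V] [Module k V] [AddCommMonoid V'] [Module k V'] [AddCommMonoid W] [Module k W]
    [AddCommMonoid W'] [Module k W'] {ρ : Representation k G V} {σ : Representation k G W}
    {ρ' : Representation k G V'} {σ' : Representation k G W'} (e : ρ.Equiv σ) (e' : ρ'.Equiv σ') :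
    (ρ.tprod ρ').Equiv (σ.tprod σ') :=
  Representation.Equiv.mk (TensorProduct.congr e.toLinearEquiv e'.toLinearEquiv) fun g =>
    TensorProduct.ext' fun v v' => by
      have h1 := e.toIntertwiningMap.isIntertwining ρ σ g v
      have h2 := e'.toIntertwiningMap.isIntertwining ρ' σ' g v'
      rw [Representation.Equiv.coe_toIntertwiningMap] at h1 h2
      simp only [LinearMap.coe_comp, Function.comp_apply, LinearEquiv.coe_coe, Representation.tprod_apply,
        TensorProduct.map_tmul, TensorProduct.congr_tmul]
      congr 1

namespace Literature.NumberTheory.GaloisRepresentations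

section WeilDeligne

variable {F : Type} [Field F] [ValuativeRel F] [TopologicalSpace F] [IsNonarchimedeanLocalField F]
  {C : Type*} [Field C] [CharZero C]
  {V : Type*} [AddCommGroup V] [Module C V] {V' : Type*} [AddCommGroup V'] [Module C V']
  {W : Type*} [AddCommGroup W] [Module C W] {W' : Type*} [AddCommGroup W'] [Module C W']

omit [CharZero C] in
/-- A tensor product of continuous (= trivial on an open subgroup of inertia) representations of
`W_F` is continuous. [cite: TateCorvallis1979, (4.1.2)] -/
theorem WeilGroup.IsContinuousRep.tprod {ρ : Representation C (WeilGroup F) V}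
    {ρ' : Representation C (WeilGroup F) V'} (h : WeilGroup.IsContinuousRep ρ)
    (h' : WeilGroup.IsContinuousRep ρ') : WeilGroup.IsContinuousRep (ρ.tprod ρ') := by
  obtain ⟨U, hU, hUo, hρ⟩ := h
  obtain ⟨U', -, hUo', hρ'⟩ := h'
  refine ⟨U ⊓ U', inf_le_left.trans hU, hUo.inter hUo', fun u hu => ?_⟩
  rw [Representation.tprod_apply, hρ u hu.1, hρ' u hu.2, TensorProduct.map_one]

namespace WeilDeligneRep

/-- **`⊗` of isomorphisms of Weil–Deligne representations**: `e ⊗ f : r ⊗ s ≅ r' ⊗ s'`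
(`TensorProduct.congr`; the monodromy `N ⊗ 1 + 1 ⊗ N` is respected).  Generalises the accepted
`Equiv.tprodLeft` (over `ℂ`, `f = refl`) to both factors and any coefficient field.
[cite: DeligneAntwerpII1973, §8.4.1] -/
def Equiv.tprodCongr {r : WeilDeligneRep F C V} {r' : WeilDeligneRep F C V'} {s : WeilDeligneRep F C W}
    {s' : WeilDeligneRep F C W'} (e : Equiv r r') (f : Equiv s s') :
    Equiv (r.tprod s) (r'.tprod s') where
  toRepEquiv := e.toRepEquiv.tprodCongr f.toRepEquiv
  comm_N := TensorProduct.ext' fun v x => by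
    have h1 : e.toLinearEquiv (r.N v) = r'.N (e.toLinearEquiv v) := congr($(e.comm_N) v)
    have h2 : f.toLinearEquiv (s.N x) = s'.N (f.toLinearEquiv x) := congr($(f.comm_N) x)
    rw [Representation.Equiv.toLinearEquiv_apply] at h1 h2
    change TensorProduct.congr e.toLinearEquiv f.toLinearEquiv ((r.tprod s).N (v ⊗ₜ x)) =
      (r'.tprod s').N (TensorProduct.congr e.toLinearEquiv f.toLinearEquiv (v ⊗ₜ x))
    simp only [tprod_N, LinearMap.add_apply, TensorProduct.map_tmul, map_add,
      TensorProduct.congr_tmul, Module.End.one_apply, Representation.Equiv.toLinearEquiv_apply, h1, h2]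

/-- **Isomorphism classes of Weil–Deligne representations are stable under `⊗`.**
[cite: DeligneAntwerpII1973, §8.4.1] -/
theorem IsEquivalent.tprod {r : WeilDeligneRep F C V} {r' : WeilDeligneRep F C V'}
    {s : WeilDeligneRep F C W} {s' : WeilDeligneRep F C W'} (h : r.IsEquivalent r')
    (h' : s.IsEquivalent s') : (r.tprod s).IsEquivalent (r'.tprod s') :=
  ⟨h.some.tprodCongr h'.some⟩

/-- An isomorphism of representations `ρ ≅ σ` is an isomorphism `(ρ, 0) ≅ (σ, 0)` of the Weil–Deligne
representations with trivial monodromy. [cite: TateCorvallis1979, (4.1.3)] -/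
def Equiv.ofRepEquiv {ρ : Representation C (WeilGroup F) V} {σ : Representation C (WeilGroup F) W}
    (e : ρ.Equiv σ) (hρ : WeilGroup.IsContinuousRep ρ) (hσ : WeilGroup.IsContinuousRep σ) :
    Equiv (ofRep ρ hρ) (ofRep σ hσ) where
  toRepEquiv := e
  comm_N := by rw [ofRep_N, ofRep_N, LinearMap.comp_zero, LinearMap.zero_comp]

/-- More generally: an isomorphism of the underlying representations of two Weil–Deligne
representations WITH `N = 0` is an isomorphism of Weil–Deligne representations. [cite: TateCorvallis1979, (4.1.3)] -/
def Equiv.ofRepEquivOfN {r : WeilDeligneRep F C V} {s : WeilDeligneRep F C W} (e : r.ρ.Equiv s.ρ)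
    (hr : r.N = 0) (hs : s.N = 0) : Equiv r s where
  toRepEquiv := e
  comm_N := by rw [hr, hs, LinearMap.comp_zero, LinearMap.zero_comp]

/-- **`(ρ, 0) ⊗ (σ, 0) = (ρ ⊗ σ, 0)`**: the identity map is an isomorphism (`N ⊗ 1 + 1 ⊗ N = 0`).
[cite: TateCorvallis1979, (4.1.5)] -/
def ofRepTprodEquiv (ρ : Representation C (WeilGroup F) V) (σ : Representation C (WeilGroup F) W)
    (hρ : WeilGroup.IsContinuousRep ρ) (hσ : WeilGroup.IsContinuousRep σ) :
    Equiv ((ofRep ρ hρ).tprod (ofRep σ hσ)) (ofRep (ρ.tprod σ) (hρ.tprod hσ)) where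
  toRepEquiv := Representation.Equiv.refl _
  comm_N := by
    rw [tprod_N, ofRep_N, ofRep_N, ofRep_N, TensorProduct.map_zero_left, TensorProduct.map_zero_right,
      add_zero, LinearMap.comp_zero, LinearMap.zero_comp]

end WeilDeligneRep

/-- **`((ρ ⊗ ρ')|_{W_F}, 0) ≅ (ρ|_{W_F}, 0) ⊗ (ρ'|_{W_F}, 0)`** for framed `ρ`, `ρ'` of `Γ_F` and the
accepted `FramedRep.tensor` (Kronecker frame). [cite: TateCorvallis1979, (4.1.5)] -/
theorem FramedRep.isEquivalent_ofRep_weilRestrict_tensor {A : Type*} [Field A] [CharZero A]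
    [TopologicalSpace A] [IsTopologicalRing A] {m n : ℕ}
    (ρ : FramedRep (absoluteGaloisGroup F) A m) (ρ' : FramedRep (absoluteGaloisGroup F) A n)
    (h : WeilGroup.IsContinuousRep (ρ.weilRestrict F)) (h' : WeilGroup.IsContinuousRep (ρ'.weilRestrict F))
    (ht : WeilGroup.IsContinuousRep ((ρ.tensor ρ').weilRestrict F)) :
    (WeilDeligneRep.ofRep ((ρ.tensor ρ').weilRestrict F) ht).IsEquivalent
      ((WeilDeligneRep.ofRep (ρ.weilRestrict F) h).tprod (WeilDeligneRep.ofRep (ρ'.weilRestrict F) h')) :=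
  ⟨((WeilDeligneRep.ofRepTprodEquiv _ _ h h').trans
      (WeilDeligneRep.Equiv.ofRepEquiv (ρ.weilRestrictTensorEquiv ρ') (h.tprod h') ht)).symm⟩

end WeilDeligne

end Literature.NumberTheory.GaloisRepresentations

end
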